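import Summits.HubbardSuperconductivity.HubbardSuperconductivity.Theorems.AnisotropyChordTransferFibre3DeltaOfLam

/-!
# Route `AnisotropyChord` / H0 rotor rung: THE GROUND PROFILE IS AN EXPLICIT FUNCTION OF `(L, λ₂)` ALONE

Packaging of the identity layer for the FIN / Level-2 producers (LEVEL2-SPEC §2–§4: every certificate quantity is evaluated from
`λ` on cells).  For the ground two-magnon profile (`IsGroundTwoMagnon L Δ lam2 f`, `L ≥ 5`, `0 ≤ Δ < 1`):
* `groundFnn L lam`, `groundCs L lam`, `groundF L lam r` — the contact value `Vλ/(4(1−Δ(λ)))`, the contact constant and the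
  profile `Δ(λ)·f_nn(λ) + c_s(λ)·a_λ(r)` off the origin (`0` at the origin), all built from `deltaOfLam` and the torus kernel `aKer` only;
* `ground_fnn_eq_explicit`: `f(x̂) = groundFnn L λ₂`; `ground_profile_aKer`: `f(r) = Δf(x̂) + c_s·a_{λ₂}(r)` off the origin;
* ★★ `ground_eq_explicit`: **`f = groundF L λ₂`** (as functions) — together with `ground_delta_eq` (`Δ = deltaOfLam L λ₂`) the pair
  `(Δ, f)` is determined by `(L, λ₂)`; with `nu_le_of_ge_7/31` the parameter ranges over `0 < λ₂ ≤ ν_max θ²`.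
Prover seat `hubbard-h0-rotor-p1` g24; helper for stmt-HubbardSuperconductivity-19089 (`--supports`).
-/

set_option linter.dupNamespace false
set_option autoImplicit false

noncomputable section

open scoped BigOperators
open Complex

namespace Summit.HubbardSuperconductivity.HubbardSuperconductivity.Theorems.AnisotropyChord.Transfer.Fibre3

variable (L : ℕ) [NeZero L]

/-- the contact value as a function of `λ`: `f_nn(λ) = Vλ/(4(1 − Δ(λ)))`. [folklore] -/
def groundFnn (lam : ℝ) : ℝ := (L : ℝ) ^ 2 * lam / (4 * (1 - deltaOfLam L lam))

/-- the contact constant as a function of `λ`: `c_s(λ) = f_nn(λ)·(4(1 − Δ(λ)) + Δ(λ)λ)`. [folklore] -/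
def groundCs (lam : ℝ) : ℝ := groundFnn L lam * (4 * (1 - deltaOfLam L lam) + deltaOfLam L lam * lam)

/-- the ground profile as a function of `λ` and the site: `0` at the origin, `Δ(λ)f_nn(λ) + c_s(λ)·a_λ(r)` elsewhere. [folklore] -/
def groundF (lam : ℝ) (r : Tor L) : ℝ :=
  if r = 0 then 0 else deltaOfLam L lam * groundFnn L lam + groundCs L lam * aKer L lam r

/-- `f(x̂) = Vλ₂/(4(1−Δ)) = groundFnn L λ₂`. [folklore] -/
theorem ground_fnn_eq_explicit (hL : 5 ≤ L) {Δ lam2 : ℝ} (hΔ0 : 0 ≤ Δ) (hΔ1 : Δ < 1) {f : Tor L → ℝ}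
    (hf : IsGroundTwoMagnon L Δ lam2 f) : f (K1 L) = groundFnn L lam2 := by
  have hsr := lam2_sum_rule L (by omega) hf.1
  unfold groundFnn
  rw [← ground_delta_eq L hL hΔ0 hΔ1 hf, eq_div_iff (by nlinarith)]
  linarith

/-- the profile through the potential kernel: `f(r) = Δ f(x̂) + c_s·a_{λ₂}(r)` for `r ≠ 0`. [folklore] -/
theorem ground_profile_aKer (hL : 5 ≤ L) {Δ lam2 : ℝ} (hΔ0 : 0 ≤ Δ) (hΔ1 : Δ < 1) {f : Tor L → ℝ}
    (hf : IsGroundTwoMagnon L Δ lam2 f) {r : Tor L} (hr : r ≠ 0) :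
    f r = Δ * f (K1 L) + cS L Δ lam2 f * aKer L lam2 r := by
  have h1 := ground_profile_eq L hL hΔ0 hΔ1 hf hr
  have h2 := cS_mul_Gres_zero L hL hΔ0 hΔ1 hf
  unfold aKer
  rw [h1, mul_sub, h2]
  ring

/-- ★★ **the ground profile is the explicit function `groundF L λ₂`.** [folklore] -/
theorem ground_eq_explicit (hL : 5 ≤ L) {Δ lam2 : ℝ} (hΔ0 : 0 ≤ Δ) (hΔ1 : Δ < 1) {f : Tor L → ℝ}
    (hf : IsGroundTwoMagnon L Δ lam2 f) : f = groundF L lam2 := by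
  funext r
  unfold groundF
  by_cases hr : r = 0
  · rw [if_pos hr, hr, hf.1.1]
  · rw [if_neg hr, ground_profile_aKer L hL hΔ0 hΔ1 hf hr]
    have hD := ground_delta_eq L hL hΔ0 hΔ1 hf
    have hF := ground_fnn_eq_explicit L hL hΔ0 hΔ1 hf
    unfold groundCs cS
    rw [← hD, ← hF]

/-- corollary: two ground profiles with the same `(L, λ₂)` coincide, whatever anisotropies they were posed at (`0 ≤ Δ, Δ' < 1`). [folklore] -/
theorem ground_determined_by_lam2 (hL : 5 ≤ L) {Δ Δ' lam2 : ℝ} (hΔ0 : 0 ≤ Δ) (hΔ1 : Δ < 1) (hΔ0' : 0 ≤ Δ') (hΔ1' : Δ' < 1)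
    {f f' : Tor L → ℝ} (hf : IsGroundTwoMagnon L Δ lam2 f) (hf' : IsGroundTwoMagnon L Δ' lam2 f') : Δ = Δ' ∧ f = f' := by
  refine ⟨?_, ?_⟩
  · rw [ground_delta_eq L hL hΔ0 hΔ1 hf, ground_delta_eq L hL hΔ0' hΔ1' hf']
  · rw [ground_eq_explicit L hL hΔ0 hΔ1 hf, ground_eq_explicit L hL hΔ0' hΔ1' hf']

end Summit.HubbardSuperconductivity.HubbardSuperconductivity.Theorems.AnisotropyChord.Transfer.Fibre3

end
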